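import HarnessLib.Audit.LibrarySuggestionsDenyListCorCM
import Summits.HodgeConjecture.CorCM.HypLiu418.A3Liu418GSPushPullPackageInjective
import Summits.HodgeConjecture.CorCM.HypLiu418.A3Liu418GSTranslateQuotient
import Literature.NumberTheory.Automorphic.Liu2021.AlbaneseComplexJacobianModel
import Literature.NumberTheory.Automorphic.Liu2021.AppendixC.HeckeTraceWordPiecesRigid
import Literature.NumberTheory.Automorphic.Liu2021.AppendixC.HeckeEndomorphismTransposedWordPackage
import Literature.NumberTheory.Automorphic.Liu2021.AppendixC.HeckeWordEntryPackage
import Literature.NumberTheory.Automorphic.Liu2021.AppendixC.HeckeLevelPackageReps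
import Literature.NumberTheory.Automorphic.Liu2021.AppendixC.HeckeTranslatePackageInjective
import Literature.AlgebraicGeometry.Motives.SepQuotientPiecePermutation
import Literature.AlgebraicGeometry.Morphisms.CofanPieceMapSection
import Literature.AlgebraicGeometry.Motives.AbelianVarietyEndRatOfIsogeny
import HarnessLib

/-!
# d6 line `a3_liu418`, `stub_RosH` GLUE — the LEVEL-ADJOINT LETTERS of a Hecke generator at the GS tower

Cell `hodgecm-mathlib` (D-0151), crux `HLiu418` = stmt-HodgeConjecture-24832, socket `SocketRosH`; this BARE PROOF FILE (theorems only)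
supplies `exists_levelAdjoint_letters_GS` = the `ext_C` binder of the filing skeleton `A3Liu418GSRosH` ((L) pen A-p02 (g14)), letter for
letter.  Count-neutral: HC_CM is proved only modulo the 7 printed citations until rung 0 closes.
CHAIN (all ★ by name; memo `A-provers/A-p18/g12/EXTC-DESIGN.A-p18g12.md`): (G1) ★ `exists_pushPull_package_GS_inj` → (M) ★
`Albanese.exists_complexJacobian_biproduct_theta_cofan` → (G2) piece maps → (G3) ★ `exists_fan_traceWord_of_rigid_injective` → (hx) ★
`…heckeEnd_eq_smul_fan_sum`; per translate (`exists_transposedBrick_letters_GS`): ★ `exists_normal_sublevel_conj`, ★ `exists_levelPackage_reps`,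
★ `exists_fan_traceWord_of_rigid`, ★ `exists_translatePackage_inj_baseChange`, ★ `Over.exists_piecePerm_of_irreducibleSpace`, the brick ★
`…heckeEnd_eq_smul_fan_sum_section`, per entry ★ `exists_subgroup_isSepQuotient_pieceMap_card` + ★ `Jacobian.exists_entry_package_guarded`;
packaging ★ `transposedWord_package_of_bricks_of_nat`; level adjointness ★ `AbelianVariety.levelAdjoint_fan_sum_weighted`.

## References
* [Liu2021] Y. Liu, *Fourier–Jacobi cycles and arithmetic relative trace formula*, Camb. J. Math. 9 (2021), §4.2, p. 133 (before (D.3)), App. C.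
* [MumfordAV1970] D. Mumford, *Abelian Varieties* (1970), §19–§21.
-/

set_option autoImplicit false

noncomputable section

namespace Summit.HodgeConjecture.CorCM.Lines.A3Liu418

open CategoryTheory CategoryTheory.Limits AlgebraicGeometry NumberField Function MonoidalCategory MulAction
open Literature.AlgebraicGeometry.Motives.AbelianVariety (bcFunctor)
open Literature.AlgebraicGeometry.Motives Literature.AlgebraicGeometry.Motives.AbelianVariety
open Literature.AlgebraicGeometry.ShimuraVarieties.UnitaryCanonicalModel
open Literature.NumberTheory.Automorphic Literature.NumberTheory.Automorphic.UnitaryGroup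
open Literature.NumberTheory.Automorphic.Liu2021 Literature.NumberTheory.Automorphic.Liu2021.AppendixC

-- `(A.baseChange L).X` is `(bcFunctor E L).obj A.X` only up to unfolding `AbelianVariety.baseChange`
set_option backward.isDefEq.respectTransparency false

section Letters

variable {F : CMField} {ι₁ : F →+* ℂ} {Jstar : Matrix (Fin 2) (Fin 2) F}
  {K₀ : C5.OpenCompactSubgroup ↥(finAdelic (↥(maximalRealSubfield F)) F (IsCMField.complexConj F) 2 Jstar)}
  (S : RecordSystemGS F Jstar ι₁ K₀) (hU7ₛ : S.HeckeTranslateDefinedOver) (hLQ : S.IsLevelQuotient)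
  (h4 : 4 ≤ Module.finrank ℚ F) (isoₛ : ℕ → Prop)

include hLQ in
/-- **THE TRANSPOSED BRICK OF ONE TRANSLATE, WITH ITS ENTRY LETTERS** (per `γ ∈ s`; steps (6a)–(6m) of the design memo).  Given the
models at `N` and `K`, the `u`-piece data `(bN, tu, H_u, ttH)`, the `T_γ`-pieces `(φγ, tpγ)` and the matched `e`, there are: a non-zero
rational `qγ`, the brick's section form `Σ_{c′} πY (bs c′) ≫ ((mst c′ : ℤ) • g c′) ≫ ιY (as c′)` of `e⁻¹ (([Kγ⁻¹K])_ℂ)` (through a normal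
`N″ ⊴ K` inside `γ⁻¹Nγ`, ★ `…heckeEnd_eq_smul_fan_sum_section`), the transposed entries `fd c′ : J_K(φγ c′) → J_K(bN c′)` identified with the
brick entries in `End(Y)`, raw weights `w c′` with `mst c′ * w c′ = n ≠ 0` uniformly, and the level-adjoint pairs
`(w c′ • (ttH c′ ≫ Nm_{tpγ c′}), fd c′)` for the K-level thetas (★ `Jacobian.exists_entry_package_guarded`).
[cite: Liu2021, §4.2 (FJcycle.tex l. 2070–2074) and p. 133 (before (D.3))] [cite: MumfordAV1970, §20 (p. 186, property (3) of e_n)] -/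
theorem exists_transposedBrick_letters_GS [Algebra (F : Type) ℂ]
    (hFR : Literature.AlgebraicGeometry.Motives.Jacobian.riemann_brillNoetherLocus_isPrincipalPolarizationDivisor)
    (hFP2 : Literature.AlgebraicGeometry.Motives.Jacobian.galoisCover_pullback_isWeilPairingAdjoint_norm)
    (hPF : ∀ (N K' : C5.SmallLevel K₀) (hn : ∀ k ∈ K'.1.1, C5.HeckeLE k N N) {Δ : Type} [Group Δ]
      (act : Δ →* Aut ((sec42DataGS S h4 isoₛ).X N))
      (_ : ∀ δ, ∃ (k : ↥(finAdelic (↥(maximalRealSubfield F)) F (IsCMField.complexConj F) 2 Jstar)) (hk : k ∈ K'.1.1), (act δ).hom = (sec42HeckeTranslatesGS S hU7ₛ h4 isoₛ).tr k N N (hn k hk))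
      (δ : Δ) (P : SchemeOver ℂ) [Nonempty ↥P.left] (e : P ⟶ (bcFunctor (F : Type) ℂ).obj ((sec42DataGS S h4 isoₛ).X N)) [IsOpenImmersion e.left],
      e ≫ (bcFunctor (F : Type) ℂ).map (act δ).hom = e → act δ = 1)
    {N K : C5.SmallLevel K₀} (hNK : N ≤ K)
    -- the K-model
    {C : Type} [Fintype C] (E' : C → SchemeOver ℂ) (hE' : ∀ c, IsSmoothProjective 1 (E' c)) (J' : ∀ c, Jacobian (E' c))
    (Y : AbelianVariety ℂ) (πY : ∀ c, Y ⟶ (J' c).J) (ιY : ∀ c, (J' c).J ⟶ Y) (ιY_πY : ∀ c, ιY c ≫ πY c = 𝟙 _)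
    (ιY_πY_ne : ∀ c c', c ≠ c' → ιY c ≫ πY c' = 0) (total : ∑ c, πY c ≫ ιY c = 𝟙 Y)
    (v : Y ⟶ ((sec42DataGS S h4 isoₛ).A K).baseChange ℂ)
    (eY : ∀ c, E' c ⟶ (bcFunctor (F : Type) ℂ).obj ((sec42DataGS S h4 isoₛ).X K))
    (lY : ∀ c, E' c ⊗ E' c ⟶ (bcFunctor (F : Type) ℂ).obj ((sec42DataGS S h4 isoₛ).alb K).nabla.N)
    (lY_incl : ∀ c, lY c ≫ (bcFunctor (F : Type) ℂ).map ((sec42DataGS S h4 isoₛ).alb K).nabla.incl =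
      (eY c ⊗ₘ eY c) ≫ Functor.LaxMonoidal.μ (bcFunctor (F : Type) ℂ) ((sec42DataGS S h4 isoₛ).X K) ((sec42DataGS S h4 isoₛ).X K))
    (lY_α : ∀ c, lY c ≫ (bcFunctor (F : Type) ℂ).map ((sec42DataGS S h4 isoₛ).alb K).α = (J' c).diff ≫ (ιY c ≫ v).hom.hom.hom)
    (W : ∀ c, CartierDivisor (J' c).J.X.left)
    (hW : ∀ c, 1 ≤ (J' c).J.dim → (J' c).IsRiemannThetaDivisor (W c) ∧ (J' c).J.IsPrincipalPolarizationDivisor (W c))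
    (hcofan : Nonempty (Limits.IsColimit (Limits.Cofan.mk ((bcFunctor (F : Type) ℂ).obj ((sec42DataGS S h4 isoₛ).X K)) eY)))
    -- the N-model (pieces, Jacobians, thetas, cofan — no fan identities needed)
    {CN : Type} [Fintype CN] (EN : CN → SchemeOver ℂ) (hEN : ∀ c, IsSmoothProjective 1 (EN c)) (JN : ∀ c, Jacobian (EN c))
    (eN : ∀ c, EN c ⟶ (bcFunctor (F : Type) ℂ).obj ((sec42DataGS S h4 isoₛ).X N))
    (WN : ∀ c, CartierDivisor (JN c).J.X.left)
    (hWN : ∀ c, 1 ≤ (JN c).J.dim → (JN c).IsRiemannThetaDivisor (WN c) ∧ (JN c).J.IsPrincipalPolarizationDivisor (WN c))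
    (hcofN : Nonempty (Limits.IsColimit (Limits.Cofan.mk ((bcFunctor (F : Type) ℂ).obj ((sec42DataGS S h4 isoₛ).X N)) eN)))
    -- the `u`-pieces with their faithful piece groups and pinned pull-backs
    (bN : CN → C) (tu : ∀ c', EN c' ⟶ E' (bN c'))
    (htu : ∀ c', tu c' ≫ eY (bN c') = eN c' ≫ (bcFunctor (F : Type) ℂ).map ((sec42DataGS S h4 isoₛ).cpt.X.map (homOfLE hNK)))
    (Hu : ∀ c', Subgroup (Aut (EN c'))) [∀ c', Finite ↥(Hu c')]
    (hqu : ∀ c', IsSepQuotient (fun h : ↥(Hu c') => (h : Aut (EN c'))) (tu c'))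
    (ttH : ∀ c', (J' (bN c')).J ⟶ (JN c').J)
    (httH : ∀ c', haveI := Fintype.ofFinite ↥(Hu c');
      (JN c').pushforward (J' (bN c')) (tu c') ≫ ttH c' = ∑ h : ↥(Hu c'), (JN c').pushforward (JN c') (h : Aut (EN c')).hom)
    (e : Y.endAlgebra ≃ₐ[ℚ] (((sec42DataGS S h4 isoₛ).A K).baseChange ℂ).endAlgebra)
    (he : ∀ (ψ : End Y) (φ : End (((sec42DataGS S h4 isoₛ).A K).baseChange ℂ)), End.asHom ψ ≫ v = v ≫ End.asHom φ →
      e (endAlgebra.of Y ψ) = endAlgebra.of _ φ)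
    (γ : ↥(finAdelic (↥(maximalRealSubfield F)) F (IsCMField.complexConj F) 2 Jstar)) (hγ : C5.HeckeLE γ N K)
    (φγ : CN → C) (tpγ : ∀ c', EN c' ⟶ E' (φγ c'))
    (htpγ : ∀ c', tpγ c' ≫ eY (φγ c') = eN c' ≫ (bcFunctor (F : Type) ℂ).map ((sec42HeckeTranslatesGS S hU7ₛ h4 isoₛ).tr γ N K hγ)) :
    ∃ (qγ : ℚ) (bs as : CN → C) (g : ∀ c', (J' (bs c')).J ⟶ (J' (as c')).J) (mst : CN → ℕ) (n : ℕ) (w : CN → ℕ)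
      (fd : ∀ c', (J' (φγ c')).J ⟶ (J' (bN c')).J),
      n ≠ 0 ∧ qγ ≠ 0 ∧
      e.symm (endAlgebraBaseChange ℂ ((sec42DataGS S h4 isoₛ).A K)
          ((sec42HeckeTranslatesGS S hU7ₛ h4 isoₛ).heckeEnd (isogenyDescent_GS S hU7ₛ hLQ h4 isoₛ) K γ⁻¹)) =
        qγ • endAlgebra.of Y (∑ c', πY (bs c') ≫ ((mst c' : ℤ) • g c') ≫ ιY (as c')) ∧
      (∀ c', πY (bs c') ≫ g c' ≫ ιY (as c') = πY (φγ c') ≫ fd c' ≫ ιY (bN c')) ∧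
      (∀ c', mst c' * w c' = n) ∧
      (∀ (c' : CN) (m : ℕ) [IsDominant (Hom.toSchemeHom ((m : ℤ) • 𝟙 (J' (bN c')).J))]
        [IsDominant (Hom.toSchemeHom ((m : ℤ) • 𝟙 (J' (φγ c')).J))]
        (P : (J' (bN c')).J.torsionPoints ℂ m) (Q : (J' (φγ c')).J.torsionPoints ℂ m),
        (J' (φγ c')).J.weilPairingLevel (W (φγ c'))
            ⟨AlgPoints.map ((w c' : ℤ) • (ttH c' ≫ (JN c').pushforward (J' (φγ c')) (tpγ c'))).hom.hom.hom P.1,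
              map_mem_torsionPoints ((w c' : ℤ) • (ttH c' ≫ (JN c').pushforward (J' (φγ c')) (tpγ c'))) P.2⟩ Q =
          (J' (bN c')).J.weilPairingLevel (W (bN c')) P ⟨AlgPoints.map (fd c').hom.hom.hom Q.1, map_mem_torsionPoints (fd c') Q.2⟩) := by
  classical
  haveI : ∀ c, IsIntegral (EN c).left := fun c => IsSmoothProjective.isIntegral_holds (hEN c)
  -- (6a) a normal sub-level `N″ ⊴ K` with `γN″γ⁻¹ ⊆ N`
  obtain ⟨N'', hN''K, hn'', hγinv⟩ := C5.SmallLevel.exists_normal_sublevel_conj N K γ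
  -- (6b) the level package of `N″ ≤ K` with honest representatives of `K ∕ N″`
  obtain ⟨Δ'', _iG'', _iF'', _iN'', act'', δ'', hδ'', hact'', hsurjN'', hinjN'', hsurj'', t'', ht'', hq''⟩ :=
    (sec42HeckeTranslatesGS S hU7ₛ h4 isoₛ).exists_levelPackage_reps (algebraMap (F : Type) ℂ) hN''K hn''
      (levelQuotientUP_GS S hU7ₛ hLQ h4 isoₛ hN''K hn'')
  -- (6c) the complex-Jacobian biproduct model at `N″`
  haveI : SmoothOfRelativeDimension 1 ((sec42DataGS S h4 isoₛ).X N'').hom := (sec42DataGS S h4 isoₛ).cpt.smooth_X N''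
  obtain ⟨C'', _iC'', E'', hE'', J'', Y'', π'', ι'', h1'', h2'', h3'', v'', hv'', e'', l'', hi'', hα'', W'', hW'', Θ'', hΘ'', hp'', hcof'',
      hirr''⟩ :=
    Literature.NumberTheory.Automorphic.Liu2021.AppendixC.Albanese.exists_complexJacobian_biproduct_theta_cofan hFR
      ((sec42DataGS S h4 isoₛ).X N'') ((sec42DataGS S h4 isoₛ).cpt.projective_X N'') ((sec42DataGS S h4 isoₛ).alb N'')
  haveI : ∀ c, IrreducibleSpace ↥(E'' c).left := hirr''
  haveI : ∀ c, IsIntegral (E'' c).left := fun c => IsSmoothProjective.isIntegral_holds (hE'' c)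
  -- (6d) the pieces of the level projection `p″ : X_{N″} → X_K`
  obtain ⟨b'', tu'', htu''⟩ :=
    Literature.AlgebraicGeometry.Morphisms.Over.exists_pieceMap_of_isColimit_cofan_of_irreducibleSpace hcofan.some e''
      ((bcFunctor (F : Type) ℂ).map ((sec42DataGS S h4 isoₛ).cpt.X.map (homOfLE hN''K)))
  -- (6e) the trace word of `p″` (constant multiplicity `m₀″`, translate rigidity)
  have hPF'' : ∀ (δ : Δ'') (P : SchemeOver ℂ) [Nonempty ↥P.left] (e' : P ⟶ (bcFunctor (F : Type) ℂ).obj ((sec42DataGS S h4 isoₛ).X N''))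
      [IsOpenImmersion e'.left], e' ≫ (bcFunctor (F : Type) ℂ).map (act'' δ).hom = e' → act'' δ = 1 :=
    fun δ P _ e' _ he' => hPF N'' K hn'' act'' (fun δ => ⟨δ'' δ, hδ'' δ, hact'' δ⟩) δ P e' he'
  obtain ⟨m₀'', H'', hH''fin, hq3, ttH'', hm₀pos, hm₀eq, httH'', hWt'', hdeck''⟩ :=
    Sec42Data.HeckeTranslates.exists_fan_traceWord_of_rigid (C := sec42DataGS S h4 isoₛ) E'' e'' J'' Y'' π'' ι'' v'' l'' E' eY J' Y
      πY ιY v lY hN''K act'' hq'' hPF'' t'' ht'' hcof''.some hE'' hcofan.some hE' h3'' h1'' h2'' total ιY_πY ιY_πY_ne hi'' hα''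
      lY_incl lY_α b'' tu'' htu''
  haveI : ∀ c', Finite ↥(H'' c') := hH''fin
  -- (6f) the translate `q′ = T_{γ⁻¹} : X_{N″} → X_N` as a quotient by a FAITHFUL deck group `Δγ`
  obtain ⟨Δγ, _iGγ, _iFγ, _iNγ, actγ, hinjγ, hactγ, hqγ, hdom, hsepN, hqγC, hdomC⟩ :=
    (sec42HeckeTranslatesGS S hU7ₛ h4 isoₛ).exists_translatePackage_inj_baseChange (algebraMap (F : Type) ℂ)
      (levelQuotientUP_GS S hU7ₛ hLQ h4 isoₛ) γ hn'' hN''K hγ hγinv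
  let actC : Δγ →* Aut ((bcFunctor (F : Type) ℂ).obj ((sec42DataGS S h4 isoₛ).X N'')) :=
    { toFun := fun δ => (bcFunctor (F : Type) ℂ).mapIso (actγ δ)
      map_one' := by rw [map_one]; exact (bcFunctor (F : Type) ℂ).mapIso_refl _
      map_mul' := fun a b => by rw [map_mul]; exact (bcFunctor (F : Type) ℂ).mapIso_trans (actγ b) (actγ a) }
  have hactC : ∀ δ, (actC δ).hom = (bcFunctor (F : Type) ℂ).map (actγ δ).hom := fun δ => rfl
  have hqγC' : IsSepQuotient (fun δ => actC δ)
      ((bcFunctor (F : Type) ℂ).map ((sec42HeckeTranslatesGS S hU7ₛ h4 isoₛ).tr γ⁻¹ N'' N hγinv)) := hqγC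
  have hsepN' : IsSeparated ((bcFunctor (F : Type) ℂ).obj ((sec42DataGS S h4 isoₛ).X N)).hom := hsepN
  have hX''proj : IsProjectiveOver ((bcFunctor (F : Type) ℂ).obj ((sec42DataGS S h4 isoₛ).X N'')) :=
    ((sec42DataGS S h4 isoₛ).cpt.projective_X N'').baseChange_obj (L := ℂ)
  -- (6g)/(6h) the deck group permutes the pieces of `X_{N″} ⊗ ℂ`; the pieces `(r, tq)` of `q′`
  obtain ⟨ρ, dk, hdk⟩ := Literature.AlgebraicGeometry.Morphisms.Over.exists_piecePerm_of_irreducibleSpace hcof''.some actC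
  letI : MulAction Δγ C'' := MulAction.compHom C'' ρ
  obtain ⟨r, tq, htq⟩ :=
    Literature.AlgebraicGeometry.Morphisms.Over.exists_pieceMap_of_isColimit_cofan_of_irreducibleSpace hcofN.some e''
      ((bcFunctor (F : Type) ℂ).map ((sec42HeckeTranslatesGS S hU7ₛ h4 isoₛ).tr γ⁻¹ N'' N hγinv))
  -- (6j) every piece of `X_N ⊗ ℂ` is hit
  have hrsurj : Function.Surjective r := by
    intro c'
    obtain ⟨P⟩ := (hEN c').nonempty_algPoints ℂ
    obtain ⟨Q, hQ⟩ := IsSepQuotient.surjective_map_of_isProjectiveOver actC _ hX''proj hsepN' hqγC' (AlgPoints.map (eN c') P)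
    obtain ⟨hc''l⟩ := Literature.AlgebraicGeometry.Morphisms.isColimit_cofan_left hcof''.some
    obtain ⟨z, y, hy⟩ := Literature.AlgebraicGeometry.Morphisms.exists_eq_of_isColimit_cofan hc''l Q.pt
    refine ⟨z, ?_⟩
    obtain ⟨hcNl⟩ := Literature.AlgebraicGeometry.Morphisms.isColimit_cofan_left hcofN.some
    by_contra hne
    have hdis := Literature.AlgebraicGeometry.Morphisms.pairwise_disjoint_range_of_isColimit_cofan hcNl hne
    refine Set.disjoint_left.mp hdis ⟨(tq z).left y, rfl⟩ ⟨P.pt, ?_⟩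
    have h1 := congrArg (fun g : E'' z ⟶ _ => g.left y) (htq z)
    simp only [Over.comp_left, Scheme.Hom.comp_apply] at h1
    have h2 := congrArg AlgPoints.pt hQ
    simp only [AlgPoints.pt_map] at h2
    rw [h1, hy, h2]
  -- (6k) one chosen piece over each piece of `X_N ⊗ ℂ`
  obtain ⟨ch, tq', hch, htq'⟩ := Literature.AlgebraicGeometry.Morphisms.Over.exists_pieceMap_section hrsurj tq htq
  -- (6i) the deck group is transitive on the pieces over each piece of `X_N ⊗ ℂ`
  have hpt'' : ∀ j, Nonempty (AlgPoints (E'' j) ℂ) := fun j => (hE'' j).nonempty_algPoints ℂ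
  have htrans : ∀ c₁ c₂ : C'', r c₁ = r c₂ → ∃ d : Δγ, d • c₁ = c₂ := fun c₁ c₂ h =>
    piecePerm_transitive_of_isSepQuotient actC _ e'' eN hX''proj hsepN' hqγC' hcof''.some hcofN.some
      (fun j => (hE'' j).isProjectiveOver) hpt'' (fun i => (hEN i).isProjectiveOver.isSeparated) r tq htq ρ dk hdk h
  -- (6l) `q′` is fixed by the deck group; the piece index `r` is invariant
  have hq'inv : ∀ d : Δγ, (actC d).hom ≫ (bcFunctor (F : Type) ℂ).map ((sec42HeckeTranslatesGS S hU7ₛ h4 isoₛ).tr γ⁻¹ N'' N hγinv) =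
      (bcFunctor (F : Type) ℂ).map ((sec42HeckeTranslatesGS S hU7ₛ h4 isoₛ).tr γ⁻¹ N'' N hγinv) := fun d => hqγC'.1 d
  have hrinv : ∀ (d : Δγ) (c : C''), r (ρ d c) = r c := fun d c =>
    Literature.AlgebraicGeometry.Morphisms.Over.pieceMap_index_unique hcofN.some (dk d c ≫ tq (ρ d c)) (tq c)
      (by rw [Category.assoc, htq, ← Category.assoc, hdk, Category.assoc, hq'inv]) (htq c)
  -- the translate `T′ = T_{γ⁻¹} : X_{N″} → X_K` of the brick is `q′ ≫ u`
  have hγ'K : C5.HeckeLE γ⁻¹ N'' K := hγinv.le_right hNK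
  have hT' : (sec42HeckeTranslatesGS S hU7ₛ h4 isoₛ).tr γ⁻¹ N'' K hγ'K =
      (sec42HeckeTranslatesGS S hU7ₛ h4 isoₛ).tr γ⁻¹ N'' N hγinv ≫ (sec42DataGS S h4 isoₛ).cpt.X.map (homOfLE hNK) := by
    rw [Sec42Data.HeckeTranslates.tr_comp_map]
  have htp'' : ∀ z, (tq z ≫ tu (r z)) ≫ eY (bN (r z)) =
      e'' z ≫ (bcFunctor (F : Type) ℂ).map ((sec42HeckeTranslatesGS S hU7ₛ h4 isoₛ).tr γ⁻¹ N'' K hγ'K) := fun z => by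
    rw [Category.assoc, htu, ← Category.assoc, htq, Category.assoc, ← Functor.map_comp, ← hT']
  have hκ : ∀ d : Δγ, (actC d).hom ≫ (bcFunctor (F : Type) ℂ).map ((sec42HeckeTranslatesGS S hU7ₛ h4 isoₛ).tr γ⁻¹ N'' K hγ'K) =
      (bcFunctor (F : Type) ℂ).map ((sec42HeckeTranslatesGS S hU7ₛ h4 isoₛ).tr γ⁻¹ N'' K hγ'K) := fun d => by
    rw [hT', Functor.map_comp, ← Category.assoc, hq'inv]
  -- (hWd) the trace word of `p″` is invariant under the `Δγ`-lifts (every `actγ d` is a translate `T_k = act″ δ″`)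
  have hWd : ∀ d : Δγ, (∑ c', πY (b'' c') ≫ ((m₀'' : ℤ) • ttH'' c') ≫ ι'' c') ≫
      (∑ c, π'' c ≫ (J'' c).pushforward (J'' (d • c)) (dk d c) ≫ ι'' (d • c)) =
      ∑ c', πY (b'' c') ≫ ((m₀'' : ℤ) • ttH'' c') ≫ ι'' c' := fun d => by
    obtain ⟨k, hk, hkd⟩ := hactγ d
    obtain ⟨δ₀, hδ₀⟩ := hsurj'' k hk
    refine hdeck'' δ₀ (fun c => ρ d c) (dk d) fun c => ?_
    rw [hdk, hactC, hkd, ← hδ₀]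
  -- (6m) THE BRICK at `(γ⁻¹, N″, K)`: the section form of `e⁻¹ (([Kγ⁻¹K])_ℂ)` (★ `…heckeEnd_eq_smul_fan_sum_section`)
  haveI : ∀ c, Mono (eY c) := fun c => mono_of_isColimit_cofan eY hcofan.some c
  haveI : ∀ c, Mono (eN c) := fun c => mono_of_isColimit_cofan eN hcofN.some c
  haveI : Fact (Nat.Prime 2) := ⟨Nat.prime_two⟩
  have ht₃ : (sec42DataGS S h4 isoₛ).Atr (homOfLE hN''K) ≫ t'' =
      ∑ d, (sec42HeckeTranslatesGS S hU7ₛ h4 isoₛ).albTr (δ'' d) N'' N'' (hn'' _ (hδ'' d)) := by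
    rw [Sec42Data.Atr_eq_map, ht'']
    refine Finset.sum_congr rfl fun d _ => ?_
    rw [Sec42Data.HeckeTranslates.albTr, ← hact'' d]
  have hD0 : Nat.card Δγ ≠ 0 := Nat.card_pos.ne'
  let m : CN → ℕ := fun c' => Nat.card Δγ / Nat.card ↥(stabilizer Δγ (ch c'))
  have hbrick := (sec42HeckeTranslatesGS S hU7ₛ h4 isoₛ).algEquiv_symm_endAlgebraBaseChange_heckeEnd_eq_smul_fan_sum_section ℂ E'' e''
    J'' Y'' π'' ι'' v'' l'' E' eY J' Y πY ιY v lY h3'' h1'' h2'' hi'' hα'' lY_incl lY_α γ⁻¹ hγ'K (fun z => bN (r z))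
    (fun z => tq z ≫ tu (r z)) htp'' t'' b'' (fun c => (m₀'' : ℤ) • ttH'' c) hWt'' (fun d => (actC d).hom) dk hdk hκ
    (fun d c => congrArg bN (hrinv d c)) hWd r hrinv htrans ch hch m hD0
    (fun c' => by rw [Fintype.card_eq_nat_card]; exact Nat.div_mul_cancel (Subgroup.card_subgroup_dvd_card _)) 2
    (isogenyDescent_GS S hU7ₛ hLQ h4 isoₛ) (hI_GS S h4 isoₛ 2) hN''K hn'' δ'' hδ'' hsurjN'' hinjN'' ht₃
    (Sec42Data.BettiPinning.finite_orbit_level (C := sec42DataGS S h4 isoₛ) K γ⁻¹) e he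
  have hq0 := Sec42Data.HeckeTranslates.heckeEnd_section_scalar_ne_zero (C := sec42DataGS S h4 isoₛ) (ι := Δ'') (Δ := Δγ) K γ⁻¹ hD0
    (Sec42Data.BettiPinning.finite_orbit_level (C := sec42DataGS S h4 isoₛ) K γ⁻¹)
  -- (6n) per entry `c′`: PIECEWISE RIGIDITY of the faithful deck group ⇒ the piece group `H_q` of `q′` at `ch c′` has `#H_q = #Stab_{Δγ}(ch c′)`
  obtain ⟨hc''l⟩ := Literature.AlgebraicGeometry.Morphisms.isColimit_cofan_left hcof''.some
  haveI : ∀ j, IsOpenImmersion (e'' j).left := fun j =>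
    Literature.AlgebraicGeometry.Morphisms.isOpenImmersion_of_isColimit_cofan hc''l j
  haveI : ∀ i, Smooth (EN i).hom := fun i =>
    haveI := (hEN i).smoothOfRelativeDimension; SmoothOfRelativeDimension.smooth 1 (EN i).hom
  have hrig : ∀ (c' : CN) (δ : Δγ), e'' (ch c') ≫ (actC δ).hom = e'' (ch c') → δ = 1 := fun c' δ h =>
    hinjγ ((hPF N'' K hn'' actγ hactγ δ (E'' (ch c')) (e'' (ch c')) h).trans (map_one actγ).symm)
  have hH := fun c' : CN =>
    exists_subgroup_isSepQuotient_pieceMap_card actC e''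
      ((bcFunctor (F : Type) ℂ).map ((sec42HeckeTranslatesGS S hU7ₛ h4 isoₛ).tr γ⁻¹ N'' N hγinv)) eN hX''proj hsepN' hqγC'
      hcof''.some hcofN.some (fun j => (hE'' j).isProjectiveOver) (fun i => (hEN i).isProjectiveOver.isSeparated) r tq htq ρ dk hdk
      (ch c') (hrig c')
  choose Hq hHqfin hqq₀ hcard using hH
  haveI : ∀ c', Finite ↥(Hq c') := hHqfin
  have hqq : ∀ c', IsSepQuotient (fun h : ↥(Hq c') => (h : Aut (E'' (ch c')))) (tq' c') := fun c' =>
    isSepQuotient_pieceMap_of_index_eq eN (fun h : ↥(Hq c') => (h : Aut (E'' (ch c')))) (hch c') (tq (ch c')) (tq' c')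
      (by rw [htq, htq']) (hqq₀ c')
  -- the index identities `b″ (ch c′) = φγ c′` (`p″ = q′ ≫ T_γ`) and `bN (r (ch c′)) = bN c′`, and the two ambient factorisations
  have hT : (bcFunctor (F : Type) ℂ).map ((sec42DataGS S h4 isoₛ).cpt.X.map (homOfLE hN''K)) =
      (bcFunctor (F : Type) ℂ).map ((sec42HeckeTranslatesGS S hU7ₛ h4 isoₛ).tr γ⁻¹ N'' N hγinv) ≫
        (bcFunctor (F : Type) ℂ).map ((sec42HeckeTranslatesGS S hU7ₛ h4 isoₛ).tr γ N K hγ) := hdomC.symm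
  have ha : ∀ c', b'' (ch c') = φγ c' := fun c' =>
    Literature.AlgebraicGeometry.Morphisms.Over.pieceMap_index_eq_of_section hcofan.some hT tq' htq' tpγ htpγ (tu'' (ch c'))
      (htu'' (ch c'))
  have hp : ∀ c', tu'' (ch c') ≫ eY (b'' (ch c')) = (tq' c' ≫ tpγ c') ≫ eY (φγ c') := fun c' =>
    (htu'' (ch c')).trans <| (congrArg (fun f => e'' (ch c') ≫ f) hT).trans
      (Literature.AlgebraicGeometry.Morphisms.Over.pieceMap_section_comp_fac tq' htq' tpγ htpγ c').symm
  have hr' : ∀ c', (tq (ch c') ≫ tu (r (ch c'))) ≫ eY (bN (r (ch c'))) = (tq' c' ≫ tu c') ≫ eY (bN c') := fun c' =>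
    (htp'' (ch c')).trans <| (congrArg (fun f => e'' (ch c') ≫ f)
      (((bcFunctor (F : Type) ℂ).congr_map hT').trans ((bcFunctor (F : Type) ℂ).map_comp _ _))).trans
        (Literature.AlgebraicGeometry.Morphisms.Over.pieceMap_section_comp_fac tq' htq' tu htu c').symm
  -- (6o) per entry: the transposed entry `fd c′` with its level-adjoint pair (★ `Jacobian.exists_entry_package_guarded`)
  have hE := fun c' : CN =>
    Literature.NumberTheory.Automorphic.Liu2021.AppendixC.Jacobian.exists_entry_package_guarded hFP2 eY J' πY ιY W (ha c')
      (congrArg bN (hch c')) (hE' (φγ c')) (hE' (bN c')) (hW (φγ c')) (hW (bN c')) (hEN c') (hE'' (ch c')) (JN c') (J'' (ch c'))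
      (hWN c') (hW'' (ch c')) (tu c') (hqu c') (ttH c') (httH c') (tq' c') (hqq c') (tpγ c') (tu'' (ch c')) (hq3 (ch c'))
      (ttH'' (ch c')) (httH'' (ch c')) (hp c') (tq (ch c') ≫ tu (r (ch c'))) (hr' c') m₀''
  choose fd hfd hf using hE
  -- (6p) the weights: `m c′ * (#H_q(c′) * m₀″) = #Δγ * m₀″`
  have hst : ∀ c', Nat.card ↥(stabilizer Δγ (ch c')) = Nat.card {δ : Δγ // ρ δ (ch c') = ch c'} := fun c' => rfl
  refine ⟨_, fun c' => b'' (ch c'), fun c' => bN (r (ch c')),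
    fun c' => ((m₀'' : ℤ) • ttH'' (ch c')) ≫ (J'' (ch c')).pushforward (J' (bN (r (ch c')))) (tq (ch c') ≫ tu (r (ch c'))), m,
    Nat.card Δγ * m₀'', fun c' => @Fintype.card ↥(Hq c') (Fintype.ofFinite _) * m₀'', fd, mul_ne_zero hD0 hm₀pos.ne', hq0, hbrick,
    fun c' => ?_, fun c' => ?_, fun c' n _ _ P Q => hf c' n P Q⟩
  · dsimp only
    rw [Preadditive.zsmul_comp]
    exact hfd c'
  · dsimp only
    rw [Fintype.card_eq_nat_card, hcard c', ← hst c', ← mul_assoc, Nat.div_mul_cancel (Subgroup.card_subgroup_dvd_card _)]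

include hLQ in
/-- **THE LEVEL-ADJOINT LETTERS OF A HECKE GENERATOR at the GS tower** (`ext_C` of the `stub_RosH` glue): for the generator `[Kγ₀K]` of
the Hecke image `ℍ_K ⊆ End⁰(A_K)`, the complex-Jacobian biproduct model `(Y, Θ′)` of `A_K ⊗ ℂ` with its matched `e : End⁰(Y) ≃ End⁰(A_K ⊗ ℂ)`,
the printed FACTS (F-R) `hFR`, (F-P2) `hFP2` and the translate rigidity (PF) `hPF` of the tower: there are `q ∈ ℚ`, words `x, xd ∈ End(Y)`,
`d ≠ 0` and `c ∈ ℍ_K` with `e⁻¹ (([Kγ₀K])_ℂ) = q • (1 ⊗ x)`, `e⁻¹ ((c)_ℂ) = 1 ⊗ xd` and `ē_n^{Θ′}((d•x) P, Q) = ē_n^{Θ′}(P, xd Q)` at every level.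
[cite: Liu2021, §4.2 (FJcycle.tex l. 2070–2074) and p. 133 (before (D.3))] [cite: MumfordAV1970, §20 (p. 186, property (3) of e_n); §21 Thm. 1 p. 192] -/
theorem exists_levelAdjoint_letters_GS [Algebra (F : Type) ℂ]
    (hFR : Literature.AlgebraicGeometry.Motives.Jacobian.riemann_brillNoetherLocus_isPrincipalPolarizationDivisor)
    (hFP2 : Literature.AlgebraicGeometry.Motives.Jacobian.galoisCover_pullback_isWeilPairingAdjoint_norm)
    (hPF : ∀ (N K' : C5.SmallLevel K₀) (hn : ∀ k ∈ K'.1.1, C5.HeckeLE k N N) {Δ : Type} [Group Δ]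
      (act : Δ →* Aut ((sec42DataGS S h4 isoₛ).X N))
      (_ : ∀ δ, ∃ (k : ↥(finAdelic (↥(maximalRealSubfield F)) F (IsCMField.complexConj F) 2 Jstar)) (hk : k ∈ K'.1.1), (act δ).hom = (sec42HeckeTranslatesGS S hU7ₛ h4 isoₛ).tr k N N (hn k hk))
      (δ : Δ) (P : SchemeOver ℂ) [Nonempty ↥P.left] (e : P ⟶ (bcFunctor (F : Type) ℂ).obj ((sec42DataGS S h4 isoₛ).X N)) [IsOpenImmersion e.left],
      e ≫ (bcFunctor (F : Type) ℂ).map (act δ).hom = e → act δ = 1)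
    (K : C5.SmallLevel K₀)
    (C : Type) [Fintype C] (E' : C → SchemeOver ℂ) (hE' : ∀ c, IsSmoothProjective 1 (E' c)) (J' : ∀ c, Jacobian (E' c))
    (Y : AbelianVariety ℂ) (πY : ∀ c, Y ⟶ (J' c).J) (ιY : ∀ c, (J' c).J ⟶ Y) (ιY_πY : ∀ c, ιY c ≫ πY c = 𝟙 _)
    (ιY_πY_ne : ∀ c c', c ≠ c' → ιY c ≫ πY c' = 0) (total : ∑ c, πY c ≫ ιY c = 𝟙 Y)
    (v : Y ⟶ ((sec42DataGS S h4 isoₛ).A K).baseChange ℂ) (_hv : IsIsogeny v)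
    (eY : ∀ c, E' c ⟶ (bcFunctor (F : Type) ℂ).obj ((sec42DataGS S h4 isoₛ).X K))
    (lY : ∀ c, E' c ⊗ E' c ⟶ (bcFunctor (F : Type) ℂ).obj ((sec42DataGS S h4 isoₛ).alb K).nabla.N)
    (lY_incl : ∀ c, lY c ≫ (bcFunctor (F : Type) ℂ).map ((sec42DataGS S h4 isoₛ).alb K).nabla.incl =
      (eY c ⊗ₘ eY c) ≫ Functor.LaxMonoidal.μ (bcFunctor (F : Type) ℂ) ((sec42DataGS S h4 isoₛ).X K) ((sec42DataGS S h4 isoₛ).X K))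
    (lY_α : ∀ c, lY c ≫ (bcFunctor (F : Type) ℂ).map ((sec42DataGS S h4 isoₛ).alb K).α = (J' c).diff ≫ (ιY c ≫ v).hom.hom.hom)
    (W : ∀ c, CartierDivisor (J' c).J.X.left)
    (hW : ∀ c, 1 ≤ (J' c).J.dim → (J' c).IsRiemannThetaDivisor (W c) ∧ (J' c).J.IsPrincipalPolarizationDivisor (W c))
    (Θ' : CartierDivisor Y.X.left) (_hΘ' : Θ'.IsAmple)
    (hpair : ∀ (N : ℕ) [IsDominant (Hom.toSchemeHom ((N : ℤ) • 𝟙 Y))]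
      (hN : ∀ c, IsDominant (Hom.toSchemeHom ((N : ℤ) • 𝟙 (J' c).J))) (P Q : Y.torsionPoints ℂ N),
      Y.weilPairingLevel Θ' P Q = ∏ c, (haveI := hN c;
        (J' c).J.weilPairingLevel (W c) ⟨AlgPoints.map (πY c).hom.hom.hom P.1, map_mem_torsionPoints (πY c) P.2⟩
          ⟨AlgPoints.map (πY c).hom.hom.hom Q.1, map_mem_torsionPoints (πY c) Q.2⟩))
    (hcofan : Nonempty (Limits.IsColimit (Limits.Cofan.mk ((bcFunctor (F : Type) ℂ).obj ((sec42DataGS S h4 isoₛ).X K)) eY)))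
    (_hirr : ∀ c, IrreducibleSpace ↥(E' c).left)
    (e : Y.endAlgebra ≃ₐ[ℚ] (((sec42DataGS S h4 isoₛ).A K).baseChange ℂ).endAlgebra)
    (he : ∀ (ψ : End Y) (φ : End (((sec42DataGS S h4 isoₛ).A K).baseChange ℂ)), End.asHom ψ ≫ v = v ≫ End.asHom φ →
      e (endAlgebra.of Y ψ) = endAlgebra.of _ φ)
    (γ₀ : ↥(finAdelic (↥(maximalRealSubfield F)) F (IsCMField.complexConj F) 2 Jstar)) :
    ∃ (q : ℚ) (x xd : End Y) (d : ℕ) (c : ↥((sec42HeckeTranslatesGS S hU7ₛ h4 isoₛ).heckeImage (isogenyDescent_GS S hU7ₛ hLQ h4 isoₛ) K)),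
      e.symm (endAlgebraBaseChange ℂ ((sec42DataGS S h4 isoₛ).A K) ((sec42HeckeTranslatesGS S hU7ₛ h4 isoₛ).heckeEnd (isogenyDescent_GS S hU7ₛ hLQ h4 isoₛ) K γ₀)) = q • endAlgebra.of Y x ∧ d ≠ 0 ∧
      e.symm (endAlgebraBaseChange ℂ ((sec42DataGS S h4 isoₛ).A K) (c : ((sec42DataGS S h4 isoₛ).A K).endAlgebra)) = endAlgebra.of Y xd ∧
      ∀ (n : ℕ) [IsDominant (Hom.toSchemeHom ((n : ℤ) • 𝟙 Y))] (P Q : Y.torsionPoints ℂ n),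
        Y.weilPairingLevel Θ' ⟨AlgPoints.map ((d : ℤ) • x).hom.hom.hom P.1, map_mem_torsionPoints ((d : ℤ) • x) P.2⟩ Q =
          Y.weilPairingLevel Θ' P ⟨AlgPoints.map xd.hom.hom.hom Q.1, map_mem_torsionPoints xd Q.2⟩ := by
  classical
  -- (G1) the faithful push–pull package of the generator
  obtain ⟨N, hNK, hn, Δ, _instG, _instF, _instN, act, hinj, hact, t, ht, s, hs, hsN, hq⟩ :=
    exists_pushPull_package_GS_inj S hU7ₛ hLQ h4 isoₛ K γ₀
  -- (M) the complex-Jacobian biproduct model at `N`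
  haveI : SmoothOfRelativeDimension 1 ((sec42DataGS S h4 isoₛ).X N).hom := (sec42DataGS S h4 isoₛ).cpt.smooth_X N
  obtain ⟨CN, _instCN, EN, hEN, JN, YN, πN, ιN, hN1, hN2, hN3, vN, hvN, eN, lN, hiN, hαN, WN, hWN, ΘN, hΘN, hpN, hcofN, hirrN⟩ :=
    Literature.NumberTheory.Automorphic.Liu2021.AppendixC.Albanese.exists_complexJacobian_biproduct_theta_cofan hFR
      ((sec42DataGS S h4 isoₛ).X N) ((sec42DataGS S h4 isoₛ).cpt.projective_X N) ((sec42DataGS S h4 isoₛ).alb N)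
  haveI : ∀ c, IrreducibleSpace ↥(EN c).left := hirrN
  -- (G2) the pieces of `u : X_N → X_K` and of the translates `T_γ`, `γ ∈ s`
  obtain ⟨bN, tu, htu⟩ :=
    Literature.AlgebraicGeometry.Morphisms.Over.exists_pieceMap_of_isColimit_cofan_of_irreducibleSpace hcofan.some eN
      ((bcFunctor (F : Type) ℂ).map ((sec42DataGS S h4 isoₛ).cpt.X.map (homOfLE hNK)))
  obtain ⟨φ, tp, htp⟩ :=
    Literature.AlgebraicGeometry.Morphisms.Over.exists_pieceMap_family_of_irreducibleSpace hcofan.some eN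
      (fun γ : ↥s => (bcFunctor (F : Type) ℂ).map ((sec42HeckeTranslatesGS S hU7ₛ h4 isoₛ).tr (γ : _) N K (hsN γ γ.2)))
  -- (G3) the trace word of `u` (multiplicity one: faithful deck group, translate rigidity)
  have hPF' : ∀ (δ : Δ) (P : SchemeOver ℂ) [Nonempty ↥P.left] (e' : P ⟶ (bcFunctor (F : Type) ℂ).obj ((sec42DataGS S h4 isoₛ).X N))
      [IsOpenImmersion e'.left], e' ≫ (bcFunctor (F : Type) ℂ).map (act δ).hom = e' → act δ = 1 :=
    fun δ P _ e' _ he' => hPF N K hn act hact δ P e' he'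
  obtain ⟨Hu, hHufin, hqu, ttH, httH, hWt, -⟩ :=
    Sec42Data.HeckeTranslates.exists_fan_traceWord_of_rigid_injective (C := sec42DataGS S h4 isoₛ) EN eN JN YN πN ιN vN lN E' eY J' Y
      πY ιY v lY hNK act hinj hq hPF' t ht hcofN.some hEN hcofan.some hE' hN3 hN1 hN2 total ιY_πY ιY_πY_ne hiN hαN lY_incl lY_α bN
      tu htu
  haveI : ∀ c', Finite ↥(Hu c') := hHufin
  -- (hx) `[Kγ₀K]` through `e` is `#Δ⁻¹` times the fan word
  choose kf hkfK hkf using hact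
  have ht' : (sec42DataGS S h4 isoₛ).Atr (homOfLE hNK) ≫ t =
      ∑ δ, (sec42HeckeTranslatesGS S hU7ₛ h4 isoₛ).albTr (kf δ) N N (hn _ (hkfK δ)) := by
    rw [Sec42Data.Atr_eq_map, ht]
    refine Finset.sum_congr rfl fun δ _ => ?_
    rw [Sec42Data.HeckeTranslates.albTr, ← hkf δ]
  haveI : Fact (Nat.Prime 2) := ⟨Nat.prime_two⟩
  have hx := (sec42HeckeTranslatesGS S hU7ₛ h4 isoₛ).algEquiv_symm_endAlgebraBaseChange_heckeEnd_eq_smul_fan_sum ℂ EN eN JN YN πN ιN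
    vN lN E' eY J' Y πY ιY v lY hN3 hN1 hN2 hiN hαN lY_incl lY_α hsN φ tp htp t bN ttH hWt 2 (isogenyDescent_GS S hU7ₛ hLQ h4 isoₛ)
    (hI_GS S h4 isoₛ 2) hNK hn kf hkfK ht' γ₀ hs e he
  -- per translate: the transposed brick with its entry letters
  have hγ := fun γ : ↥s =>
    exists_transposedBrick_letters_GS S hU7ₛ hLQ h4 isoₛ hFR hFP2 hPF hNK E' hE' J' Y πY ιY ιY_πY ιY_πY_ne total v eY lY lY_incl lY_α
      W hW hcofan EN hEN JN eN WN hWN hcofN bN tu htu Hu hqu ttH httH e he (γ : _)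
      (hsN γ γ.2) (φ γ) (tp γ) (htp γ)
  choose qγ bs as g mst nγ w fd hn0 hq0 hbrick hfd hwst hf using hγ
  obtain ⟨fd', w', m', D, hD0, hm', c, hxd, hf'⟩ :=
    (sec42HeckeTranslatesGS S hU7ₛ h4 isoₛ).transposedWord_package_of_bricks_of_nat ℂ EN JN E' J' Y πY ιY W
      (isogenyDescent_GS S hU7ₛ hLQ h4 isoₛ) e s φ tp bN ttH nγ hn0 (fun γ => (γ : _)⁻¹) qγ bs as g mst hq0 hbrick
      (fun i => fd i.1 i.2) (fun γ c' => hfd γ c') (fun i => w i.1 i.2) (fun γ c' => hwst γ c') (fun i m _ _ P Q => hf i.1 i.2 m P Q)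
  -- the level adjointness on the biproduct model (★ `levelAdjoint_fan_sum_weighted`)
  have hY : ∀ (n : ℕ) [IsDominant (Hom.toSchemeHom ((n : ℤ) • 𝟙 Y))], ∀ c, IsDominant (Hom.toSchemeHom ((n : ℤ) • 𝟙 (J' c).J)) :=
    fun n _ c => isDominant_toSchemeHom_zsmul_id_of_comp_eq_id (πY c) (ιY c) (ιY_πY c) (n : ℤ)
  refine ⟨((Fintype.card Δ : ℚ))⁻¹, _, _, D, c, hx, hD0, hxd, fun n _ P Q => ?_⟩
  exact levelAdjoint_fan_sum_weighted πY ιY ιY_πY ιY_πY_ne W Θ' (fun N _ _ P Q => hpair N (fun c => inferInstance) P Q)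
    (s.attach ×ˢ (Finset.univ : Finset CN)) (fun i => bN i.2) (fun i => φ i.1 i.2)
    (fun i => ttH i.2 ≫ (JN i.2).pushforward (J' (φ i.1 i.2)) (tp i.1 i.2)) fd' w' m' hm' hf' hY n P Q

end Letters

end Summit.HodgeConjecture.CorCM.Lines.A3Liu418

end
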